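import Summits.QuantumAdvantage.QuantumAdvantage.Theorems.WbwObfuscatedGluedTreesKowBbVocabulary

/-!
# Stub `stub_bitToQuery` — black-box access to the neighbour circuit is no more than the list oracle
# (crux `WbwObfuscatedGluedTrees`, stmt-QuantumAdvantage-2340; line `knowledge-of-walk-split`, stage 5, black-box soundness)

The ideal-model walker of stage 5 has BLACK-BOX access to the instance's neighbour circuit, i.e. oracle access to
the BIT oracle `bitOracle σ ν` of the functionality `nbrBit σ ν` (one output bit per query `(a, b) ∈ {0,1}^{2N}`),
is handed `x ++ name(ENTRANCE)` and succeeds (`BitSuccess`) if it OUTPUTS a string with `name(EXIT)` as a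
prefix.  The walker of ChildsEtAl2003, Theorem 9 has the LIST oracle `strOracle σ ν` and wins (`FindsExitN`) if it
QUERIES `name(EXIT)`.  This file proves that the first is no stronger than the second, by a round-for-round
simulation `listSim N M` of a bit-oracle algorithm `M`:

* a bit query `q = (a, b)` of length `2N` becomes the list query `a = q.take N`; the bit `nbrBit σ ν (a, b)` is
  READ OFF the list answer `s = strOracle σ ν a` (the flattened sorted neighbour names, `|s| = N · #nbrs`) as bit
  `nameVal b` of `fit (3N+2) (bitsOf 2 (|s| / N) ++ s) = answerBits σ ν a` (`bitOfList`, `bitOracle_eq_bitOfList`);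
* since translating the `i`-th answer needs `M`'s `i`-th query, the simulator reconstructs `M`'s bit transcript
  from its own list transcript by a replay (`bitAnswers`), and asks what `M` would ask next;
* when `M` outputs `y`, the simulator QUERIES `y.take N` — so an output with prefix `name(EXIT)` within `t` rounds
  becomes the query `name(EXIT)` within `t` rounds (`take_mem_queriesAux`, `stub_bitToQuery`).

[folklore] (BarakEtAl2012 Def. 2.2: black-box access to an obfuscated circuit is oracle access to its
functionality; ChildsEtAl2003 §4 Game 1: the winning condition is a query of name(EXIT).)
-/

set_option linter.dupNamespace false

noncomputable section

namespace Summit.QuantumAdvantage.QuantumAdvantage.Theorems.WbwObfuscatedGluedTrees.KnowledgeOfWalk.BlackBox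

open Literature.Computability.Complexity Literature.Computability.QuantumComplexity
open Literature.Computability.QuantumComplexity.GluedTrees
open Literature.Computability.Cryptography Literature.Computability.Cryptography.ObfuscatedGluedTrees

variable {d N : ℕ}

/-- **The bit answer read off a list answer**: for a bit query `q = (a, b)` of length `2N` and the list answer
`s = strOracle σ ν a`, the one-bit answer `[bit (nameVal b) of fit (3N+2) (bitsOf 2 (|s|/N) ++ s)]`; the empty
answer for queries of any other length (as `bitOracle` gives). [folklore] -/
def bitOfList (N : ℕ) (q s : List Bool) : List Bool :=
  if h : q.length = N + N then
    [(fit (ansLen N) (bitsOf 2 (s.length / N) ++ s)).getD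
      (nameVal fun i : Fin N => q.get ((Fin.natAdd N i).cast h.symm)) false]
  else []

/-- **Replay**: the bit transcript of `M` (input `x₀`) reconstructed from a list transcript `as'` — the `i`-th
list answer is translated by `bitOfList` at the `i`-th query of `M`, found by re-running `M` on the answers
translated so far; answers received after `M` has halted are dropped. [folklore] -/
def bitAnswers (N : ℕ) (M : OracleAlg (List Bool)) (x₀ : List Bool) (as' : List (List Bool)) :
    List (List Bool) :=
  as'.foldl (fun acc s =>
    match M.step x₀ acc with
    | Sum.inl q => acc ++ [bitOfList N q s]
    | Sum.inr _ => acc) []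

/-- **The list-oracle simulator of a bit-oracle algorithm** `M`: replay the bit transcript, then ask the name
part `q.take N` of `M`'s next bit query `q`, or — once `M` outputs `y` — ask `y.take N` (and keep asking it; the
simulator never outputs). [folklore] -/
def listSim (N : ℕ) (M : OracleAlg (List Bool)) : OracleAlg (List Bool) where
  step x₀ as' :=
    match M.step x₀ (bitAnswers N M x₀ as') with
    | Sum.inl q => Sum.inl (q.take N)
    | Sum.inr y => Sum.inl (y.take N)

/-- The replay of the empty transcript is empty. [folklore] -/
@[simp] theorem bitAnswers_nil (N : ℕ) (M : OracleAlg (List Bool)) (x₀ : List Bool) :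
    bitAnswers N M x₀ [] = [] :=
  rfl

/-- One more list answer: translated and appended if `M` is still querying, dropped otherwise. [folklore] -/
theorem bitAnswers_append_singleton (N : ℕ) (M : OracleAlg (List Bool)) (x₀ : List Bool)
    (as' : List (List Bool)) (s : List Bool) :
    bitAnswers N M x₀ (as' ++ [s]) =
      match M.step x₀ (bitAnswers N M x₀ as') with
      | Sum.inl q => bitAnswers N M x₀ as' ++ [bitOfList N q s]
      | Sum.inr _ => bitAnswers N M x₀ as' := by
  simp only [bitAnswers, List.foldl_append, List.foldl_cons, List.foldl_nil]

/-- The step of the simulator, unfolded. [folklore] -/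
theorem listSim_step (N : ℕ) (M : OracleAlg (List Bool)) (x₀ : List Bool) (as' : List (List Bool)) :
    (listSim N M).step x₀ as' =
      match M.step x₀ (bitAnswers N M x₀ as') with
      | Sum.inl q => Sum.inl (q.take N)
      | Sum.inr y => Sum.inl (y.take N) :=
  rfl

/-- The list answer to the name part of a `2N`-bit query is the flattened neighbour list of the queried name.
[folklore] -/
theorem strOracle_take {q : List Bool} (σ : CycleDatum d) (ν : NamingN d N) (h : q.length = N + N) :
    strOracle σ ν (q.take N) =
      ((gluedTreesOracle σ ν fun i : Fin N => q.get ((Fin.castAdd N i).cast h.symm)).map List.ofFn).flatten := by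
  have h' : (q.take N).length = N := by simp [h]
  unfold strOracle
  rw [dif_pos h']
  congr 3
  funext i
  simp [List.getElem_take]

/-- **Oracle correspondence**: the bit oracle's answer to `q` is read off the list oracle's answer to `q.take N`
by `bitOfList` (`1 ≤ N`, to recover the neighbour count `|s| / N`). [folklore] -/
theorem bitOracle_eq_bitOfList (hN : 1 ≤ N) (σ : CycleDatum d) (ν : NamingN d N) (q : List Bool) :
    bitOracle σ ν q = bitOfList N q (strOracle σ ν (q.take N)) := by
  unfold bitOracle bitOfList
  by_cases h : q.length = N + N
  · rw [dif_pos h, dif_pos h, strOracle_take σ ν h, length_flatten_map_ofFn, Nat.mul_div_cancel _ hN]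
    rfl
  · rw [dif_neg h, dif_neg h]

/-- **The simulation, round by round**: if `M`, continued for `k` rounds against the bit oracle from the replay
of a list transcript `as'`, outputs `y`, then the simulator continued for `k` rounds against the list oracle
from `as'` queries `y.take N`. [folklore] -/
theorem take_mem_queriesAux (hN : 1 ≤ N) (M : OracleAlg (List Bool)) (σ : CycleDatum d) (ν : NamingN d N)
    (x₀ : List Bool) :
    ∀ (k : ℕ) (as' : List (List Bool)) (y : List Bool),
      M.runAux (bitOracle σ ν) x₀ k (bitAnswers N M x₀ as') = some y →
        y.take N ∈ (listSim N M).queriesAux (strOracle σ ν) x₀ k as'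
  | 0, _, _, h => by simp at h
  | k + 1, as', y, h => by
    rw [queriesAux_succ_eq, listSim_step]
    rw [OracleAlg.runAux_succ] at h
    cases hs : M.step x₀ (bitAnswers N M x₀ as') with
    | inl q =>
      rw [hs] at h
      refine List.mem_cons_of_mem _ (take_mem_queriesAux hN M σ ν x₀ k _ y ?_)
      rw [bitAnswers_append_singleton, hs]
      simpa only [← bitOracle_eq_bitOfList hN σ ν q] using h
    | inr b =>
      rw [hs] at h
      obtain rfl : b = y := by simpa using h
      exact List.mem_cons_self

/-- **Stub `stub_bitToQuery`** (black-box access to the circuit is no more than the list oracle): a bit-oracle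
algorithm that OUTPUTS a string with `name(EXIT)` as a prefix within `t` rounds is simulated by a list-oracle algorithm
that QUERIES `name(EXIT)` within `t` rounds (each bit query `(a, b)` becomes the list query `a`, the bit being read off
the answer; the final output `y` becomes the query `y.take N`). [folklore] -/
theorem stub_bitToQuery : ∀ (N : ℕ), 1 ≤ N → ∀ (M : OracleAlg (List Bool)), ∃ M' : OracleAlg (List Bool),
    ∀ (d : ℕ) (x : List Bool) (t : ℕ) (σ : CycleDatum d) (ν : NamingN d N),
      BitSuccess M x t σ ν → FindsExitN M' x t (σ, ν) := by
  intro N hN M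
  refine ⟨listSim N M, fun d x t σ ν ⟨y, hrun, hpre⟩ => ?_⟩
  have hy : List.ofFn (ν (GluedTrees.exit d)) = y.take N := by
    simpa using List.prefix_iff_eq_take.1 hpre
  have hmem := take_mem_queriesAux hN M σ ν _ t [] y (by simpa [OracleAlg.run] using hrun)
  simpa [FindsExitN, OracleAlg.queries, hy] using hmem

end Summit.QuantumAdvantage.QuantumAdvantage.Theorems.WbwObfuscatedGluedTrees.KnowledgeOfWalk.BlackBox

end
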